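import Summits.Ventures.PercRepro.S1EightSixFiveNineThreeFive

/-!
# PercRepro — AT MOST TWO 4-POINT LINES ON 8 POINTS, AND AT MOST 13 RANK-2 TRIPLES (p2, gen 28; SUBCLAIM-S1 §6.10
(xvii)(p); towards the last `(8, 6)` shape)

In a matroid with all pairs of rank `2` whose pairs have closures of at most `4` points, two distinct rank-`2`
four-sets share at most one point (a common pair would put both inside one closure of `≤ 4` points); three of them
would need `4 + 3 + 2 = 9` points, so on `8` points there are at most two. Counting the incidences «a rank-`2` triple
with one of its pairs»: a pair inside a rank-`2` four-set lies in `2` triples, any other pair in at most `1`, and the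
pairs inside the four-sets number `6 q₂`: `3 t ≤ 28 + 6 q₂ ≤ 40`, so `t ≤ 13`. Nothing is claimed about any cell.

* `ncard_inter_le_one_of_rankTwo_four`, `ncard_rankTwoSets_four_le_two`, `three_mul_ncard_rankTwoTriples_le_eight`.
Axioms: standard.
-/

open scoped Matroid

namespace PercRepro

namespace S1

open Set

variable {α : Type}

section Lines

variable {M : Matroid α} [M.Finite] (hpairs : ∀ e ∈ M.E, ∀ f ∈ M.E, e ≠ f → M.eRk {e, f} = 2)
  (hcl : ∀ x ∈ M.E, ∀ y ∈ M.E, x ≠ y → (M.closure {x, y}).ncard ≤ 4)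

include hpairs

/-- A rank-`2` set lies inside the closure of any of its pairs. -/
theorem subset_closure_pair_of_eRk_two {X : Set α} (hXE : X ⊆ M.E) (hX2 : M.eRk X = 2) {x y : α} (hx : x ∈ X)
    (hy : y ∈ X) (hxy : x ≠ y) : X ⊆ M.closure {x, y} := by
  intro z hz
  have hPE : ({x, y} : Set α) ⊆ M.E := insert_subset (hXE hx) (singleton_subset_iff.mpr (hXE hy))
  rw [mem_closure_iff_eRk_insert_eq M (hXE hz) hPE]
  have hle : M.eRk (insert z {x, y}) ≤ M.eRk X :=
    M.eRk_mono (insert_subset hz (insert_subset hx (singleton_subset_iff.mpr hy)))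
  have hge : M.eRk {x, y} ≤ M.eRk (insert z {x, y}) := M.eRk_mono (subset_insert _ _)
  rw [hX2] at hle
  rw [hpairs x (hXE hx) y (hXE hy) hxy] at hge ⊢
  exact le_antisymm hle hge

include hcl

/-- Two distinct rank-`2` four-sets share at most one point. -/
theorem ncard_inter_le_one_of_rankTwo_four {Q Q' : Set α} (hQ : Q ∈ rankTwoSets M 4) (hQ' : Q' ∈ rankTwoSets M 4)
    (hne : Q ≠ Q') : (Q ∩ Q').ncard ≤ 1 := by
  by_contra hlt
  push Not at hlt
  obtain ⟨x, hx, y, hy, hxy⟩ := (Set.one_lt_ncard ((M.ground_finite.subset hQ.1).inter_of_left _)).mp hlt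
  -- both lie inside `cl {x, y}`, which has at most `4` points, hence both equal it
  have hQcl := subset_closure_pair_of_eRk_two hpairs hQ.1 hQ.2.2 hx.1 hy.1 hxy
  have hQ'cl := subset_closure_pair_of_eRk_two hpairs hQ'.1 hQ'.2.2 hx.2 hy.2 hxy
  have hclfin : (M.closure {x, y}).Finite := M.ground_finite.subset (M.closure_subset_ground _)
  have h4 := hcl x (hQ.1 hx.1) y (hQ.1 hy.1) hxy
  have hQeq : Q = M.closure {x, y} := eq_of_subset_of_ncard_le hQcl (by rw [hQ.2.1]; exact h4) hclfin
  have hQ'eq : Q' = M.closure {x, y} := eq_of_subset_of_ncard_le hQ'cl (by rw [hQ'.2.1]; exact h4) hclfin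
  exact hne (hQeq.trans hQ'eq.symm)

/-- At most two rank-`2` four-sets on `8` points. -/
theorem ncard_rankTwoSets_four_le_two (hE : M.E.ncard = 8) : (rankTwoSets M 4).ncard ≤ 2 := by
  by_contra hlt
  push Not at hlt
  obtain ⟨A, hA, B, hB, C, hC, hAB, hAC, hBC⟩ := (Set.two_lt_ncard (rankTwoSets_finite M 4)).mp hlt
  have hAfin : A.Finite := M.ground_finite.subset hA.1
  have hBfin : B.Finite := M.ground_finite.subset hB.1
  have hCfin : C.Finite := M.ground_finite.subset hC.1
  have h1 := ncard_union_add_ncard_inter A B hAfin hBfin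
  have h2 := ncard_union_add_ncard_inter (A ∪ B) C (hAfin.union hBfin) hCfin
  have hAB' := ncard_inter_le_one_of_rankTwo_four hpairs hcl hA hB hAB
  have hAC' := ncard_inter_le_one_of_rankTwo_four hpairs hcl hA hC hAC
  have hBC' := ncard_inter_le_one_of_rankTwo_four hpairs hcl hB hC hBC
  have hsub : (A ∪ B) ∩ C ⊆ (A ∩ C) ∪ (B ∩ C) := by
    rintro z ⟨hz | hz, hzC⟩
    · exact Or.inl ⟨hz, hzC⟩
    · exact Or.inr ⟨hz, hzC⟩
  have h3 : ((A ∪ B) ∩ C).ncard ≤ 2 := by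
    refine (ncard_le_ncard hsub ((hAfin.inter_of_left _).union (hBfin.inter_of_left _))).trans ?_
    exact (ncard_union_le _ _).trans (by omega)
  have hall : (A ∪ B ∪ C).ncard ≤ 8 := by
    have := ncard_le_ncard (union_subset (union_subset hA.1 hB.1) hC.1) M.ground_finite
    rwa [hE] at this
  have hA4 := hA.2.1
  have hB4 := hB.2.1
  have hC4 := hC.2.1
  omega

/-- `3 t ≤ 28 + 6 q₂` on `8` points: a pair in a rank-`2` four-set lies in `2` triples, any other pair in at most
`1`; hence `t ≤ 13`. -/
theorem three_mul_ncard_rankTwoTriples_le_eight (hE : M.E.ncard = 8) : 3 * (rankTwoSets M 3).ncard ≤ 40 := by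
  -- over each pair `P`: the triples containing `P` are `P ∪ {z}`, `z ∈ cl P ∖ P`; if `|cl P| = 4` then `cl P` is a
  -- rank-`2` four-set. We bound by `2` per pair inside a four-set and `1` otherwise, through the two sets of pairs.
  have hq2 := ncard_rankTwoSets_four_le_two hpairs hcl hE
  -- the general incidence count gives `3 t ≤ 2 · 28` only; refine: pairs `P` with `|cl P| ≤ 3` carry `≤ 1` triple
  have hTfin := rankTwoSets_finite M 3
  have hQfin : (rankTwoSetPairs M 3).Finite :=
    (M.ground_finite.finite_subsets.prod M.ground_finite.finite_subsets).subset
      (fun Q hQ => ⟨hQ.1.1, hQ.2.1.trans hQ.1.1⟩)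
  -- lower side: `3` pairs per triple
  have hlow : 3 * (rankTwoSets M 3).ncard = (rankTwoSetPairs M 3).ncard := by
    have heq : rankTwoSetPairs M 3 = ⋃ X ∈ rankTwoSets M 3,
        ({X} ×ˢ {P : Set α | P ⊆ X ∧ P.ncard = 2} : Set (Set α × Set α)) := by
      ext ⟨X, P⟩
      simp only [rankTwoSetPairs, mem_setOf_eq, mem_iUnion, mem_prod, mem_singleton_iff, exists_prop]
      constructor
      · rintro ⟨hX, hPX, hP2⟩
        exact ⟨X, hX, rfl, hPX, hP2⟩
      · rintro ⟨X', hX', rfl, hPX, hP2⟩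
        exact ⟨hX', hPX, hP2⟩
    have hfib : ∀ X ∈ rankTwoSets M 3, (({X} ×ˢ {P : Set α | P ⊆ X ∧ P.ncard = 2} : Set (Set α × Set α))).Finite :=
      fun X hX => (finite_singleton X).prod ((M.ground_finite.subset hX.1).finite_subsets.subset (fun _ hP => hP.1))
    have hdisj : (rankTwoSets M 3).PairwiseDisjoint
        (fun X : Set α => ({X} ×ˢ {P : Set α | P ⊆ X ∧ P.ncard = 2} : Set (Set α × Set α))) := by
      intro X _ X' _ hXX
      rw [Function.onFun, Set.disjoint_left]
      rintro ⟨C, P⟩ ⟨hC1, -⟩ ⟨hC2, -⟩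
      apply hXX
      rw [mem_singleton_iff] at hC1 hC2
      rw [← hC1, ← hC2]
    rw [heq, hTfin.ncard_biUnion hfib hdisj, finsum_mem_eq_finite_toFinset_sum _ hTfin]
    rw [Finset.sum_congr rfl (g := fun _ => 3) ?_]
    · rw [Finset.sum_const, smul_eq_mul, ncard_eq_toFinset_card _ hTfin, mul_comm]
    · intro X hX
      rw [Finite.mem_toFinset] at hX
      rw [ncard_prod, ncard_singleton, one_mul, ncard_setOf_subset_ncard_eq (M.ground_finite.subset hX.1) 2,
        hX.2.1]
      rfl
  -- upper side: split the pairs into those inside a rank-`2` four-set (`≤ 6 q₂ ≤ 12`, `≤ 2` triples each) and the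
  -- others (`≤ 28`, `≤ 1` triple each)
  have hPfin : {P : Set α | P ⊆ M.E ∧ P.ncard = 2}.Finite :=
    M.ground_finite.finite_subsets.subset (fun _ hP => hP.1)
  let big : Set (Set α) := {P : Set α | P ⊆ M.E ∧ P.ncard = 2 ∧ ∃ Q ∈ rankTwoSets M 4, P ⊆ Q}
  let small : Set (Set α) := {P : Set α | P ⊆ M.E ∧ P.ncard = 2 ∧ ¬ ∃ Q ∈ rankTwoSets M 4, P ⊆ Q}
  have hbigfin : big.Finite := hPfin.subset (fun P hP => ⟨hP.1, hP.2.1⟩)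
  have hsmallfin : small.Finite := hPfin.subset (fun P hP => ⟨hP.1, hP.2.1⟩)
  -- the fibre over a pair `P`
  have hfibP : ∀ P ∈ {P : Set α | P ⊆ M.E ∧ P.ncard = 2},
      {R ∈ rankTwoSetPairs M 3 | R.2 = P}.ncard ≤ (M.closure P).ncard - 2 := by
    rintro P ⟨hPE, hP2⟩
    have hsubcl : P ⊆ M.closure P := M.subset_closure P hPE
    have hclfin : (M.closure P).Finite := M.ground_finite.subset (M.closure_subset_ground _)
    have hsub : {R ∈ rankTwoSetPairs M 3 | R.2 = P} ⊆ (fun z => (insert z P, P)) '' (M.closure P \ P) := by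
      rintro ⟨T, P'⟩ ⟨⟨⟨hTE, hT3, hT2⟩, hPT, -⟩, hPP⟩
      have hPP' : P = P' := (hPP : P' = P).symm
      subst hPP'
      have hTfin' : T.Finite := M.ground_finite.subset hTE
      have h1 : (T \ P).ncard = 1 := by rw [ncard_sdiff' hPT hTfin', hT3, hP2]
      obtain ⟨z, hz⟩ := ncard_eq_one.mp h1
      have hzmem : z ∈ T \ P := by rw [hz]; exact mem_singleton z
      have hTeq : T = insert z P := by
        ext w
        constructor
        · intro hw
          by_cases hwP : w ∈ P
          · exact Or.inr hwP
          · have : w ∈ T \ P := ⟨hw, hwP⟩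
            rw [hz] at this
            exact Or.inl this
        · rintro (rfl | hw)
          · exact hzmem.1
          · exact hPT hw
      obtain ⟨x, y, hxy, rfl⟩ := ncard_eq_two.mp hP2
      refine ⟨z, ⟨?_, hzmem.2⟩, ?_⟩
      · exact subset_closure_pair_of_eRk_two hpairs hTE hT2 (hPT (by simp)) (hPT (by simp)) hxy hzmem.1
      · simp only [Prod.mk.injEq, and_true]
        exact hTeq.symm
    have hfin' : (M.closure P \ P).Finite := hclfin.subset sdiff_subset
    refine (ncard_le_ncard hsub (hfin'.image _)).trans ((ncard_image_le hfin').trans ?_)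
    rw [ncard_sdiff' hsubcl hclfin, hP2]
  have hfibBig : ∀ P ∈ big, {R ∈ rankTwoSetPairs M 3 | R.2 = P}.ncard ≤ 2 := by
    rintro P ⟨hPE, hP2, -⟩
    refine (hfibP P ⟨hPE, hP2⟩).trans ?_
    obtain ⟨x, y, hxy, rfl⟩ := ncard_eq_two.mp hP2
    have := hcl x (hPE (by simp)) y (hPE (by simp)) hxy
    omega
  have hfibSmall : ∀ P ∈ small, {R ∈ rankTwoSetPairs M 3 | R.2 = P}.ncard ≤ 1 := by
    rintro P ⟨hPE, hP2, hno⟩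
    refine (hfibP P ⟨hPE, hP2⟩).trans ?_
    -- `|cl P| ≤ 3`: otherwise `cl P` is a rank-`2` four-set containing `P`
    obtain ⟨x, y, hxy, rfl⟩ := ncard_eq_two.mp hP2
    have h4 := hcl x (hPE (by simp)) y (hPE (by simp)) hxy
    by_contra hgt
    push Not at hgt
    apply hno
    refine ⟨M.closure {x, y}, ⟨M.closure_subset_ground _, by omega, ?_⟩, M.subset_closure _ hPE⟩
    rw [M.eRk_closure_eq, hpairs x (hPE (by simp)) y (hPE (by simp)) hxy]
  -- the pairs inside the four-sets: at most `6 q₂ ≤ 12`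
  have hbig : big.ncard ≤ 12 := by
    have hsub : big ⊆ ⋃ Q ∈ rankTwoSets M 4, {P : Set α | P ⊆ Q ∧ P.ncard = 2} := by
      rintro P ⟨-, hP2, Q, hQ, hPQ⟩
      rw [mem_iUnion₂]
      exact ⟨Q, hQ, hPQ, hP2⟩
    have hQ4fin := rankTwoSets_finite M 4
    refine (ncard_le_ncard hsub (hQ4fin.biUnion (fun Q hQ =>
      (M.ground_finite.subset hQ.1).finite_subsets.subset (fun _ hP => hP.1)))).trans ?_
    refine (hQ4fin.ncard_biUnion_le _).trans ?_
    rw [finsum_mem_eq_finite_toFinset_sum _ hQ4fin]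
    calc ∑ Q ∈ hQ4fin.toFinset, {P : Set α | P ⊆ Q ∧ P.ncard = 2}.ncard ≤ hQ4fin.toFinset.card • 6 := by
          apply Finset.sum_le_card_nsmul
          intro Q hQ
          rw [Finite.mem_toFinset] at hQ
          rw [ncard_setOf_subset_ncard_eq (M.ground_finite.subset hQ.1) 2, hQ.2.1]
          decide
      _ ≤ 12 := by
          rw [smul_eq_mul, ← ncard_eq_toFinset_card _ hQ4fin]
          omega
  have hbs : big.ncard + small.ncard ≤ 28 := by
    have hsub' : big ∪ small ⊆ {P : Set α | P ⊆ M.E ∧ P.ncard = 2} := by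
      rintro P (⟨hPE, hP2, -⟩ | ⟨hPE, hP2, -⟩) <;> exact ⟨hPE, hP2⟩
    have h := ncard_le_ncard hsub' hPfin
    rwa [ncard_union_eq (by rw [Set.disjoint_left]; rintro P ⟨-, -, hb⟩ ⟨-, -, hnb⟩; exact hnb hb) hbigfin hsmallfin,
      ncard_setOf_subset_ncard_eq M.ground_finite 2, hE, show Nat.choose 8 2 = 28 by decide] at h
  have hup : rankTwoSetPairs M 3 ⊆ (⋃ P ∈ big, {R ∈ rankTwoSetPairs M 3 | R.2 = P}) ∪
      (⋃ P ∈ small, {R ∈ rankTwoSetPairs M 3 | R.2 = P}) := by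
    rintro ⟨X, P⟩ ⟨hX, hPX, hP2⟩
    by_cases hb : ∃ Q ∈ rankTwoSets M 4, P ⊆ Q
    · left; rw [mem_iUnion₂]; exact ⟨P, ⟨hPX.trans hX.1, hP2, hb⟩, ⟨hX, hPX, hP2⟩, rfl⟩
    · right; rw [mem_iUnion₂]; exact ⟨P, ⟨hPX.trans hX.1, hP2, hb⟩, ⟨hX, hPX, hP2⟩, rfl⟩
  calc 3 * (rankTwoSets M 3).ncard = (rankTwoSetPairs M 3).ncard := hlow
    _ ≤ ((⋃ P ∈ big, {R ∈ rankTwoSetPairs M 3 | R.2 = P}) ∪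
          (⋃ P ∈ small, {R ∈ rankTwoSetPairs M 3 | R.2 = P})).ncard :=
        ncard_le_ncard hup ((hbigfin.biUnion (fun P _ => hQfin.subset (fun R hR => hR.1))).union
          (hsmallfin.biUnion (fun P _ => hQfin.subset (fun R hR => hR.1))))
    _ ≤ (⋃ P ∈ big, {R ∈ rankTwoSetPairs M 3 | R.2 = P}).ncard +
          (⋃ P ∈ small, {R ∈ rankTwoSetPairs M 3 | R.2 = P}).ncard := ncard_union_le _ _
    _ ≤ (∑ᶠ P ∈ big, {R ∈ rankTwoSetPairs M 3 | R.2 = P}.ncard) +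
          ∑ᶠ P ∈ small, {R ∈ rankTwoSetPairs M 3 | R.2 = P}.ncard :=
        Nat.add_le_add (hbigfin.ncard_biUnion_le _) (hsmallfin.ncard_biUnion_le _)
    _ = (∑ P ∈ hbigfin.toFinset, {R ∈ rankTwoSetPairs M 3 | R.2 = P}.ncard) +
          ∑ P ∈ hsmallfin.toFinset, {R ∈ rankTwoSetPairs M 3 | R.2 = P}.ncard := by
        rw [finsum_mem_eq_finite_toFinset_sum _ hbigfin, finsum_mem_eq_finite_toFinset_sum _ hsmallfin]
    _ ≤ hbigfin.toFinset.card • 2 + hsmallfin.toFinset.card • 1 := by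
        apply Nat.add_le_add
        · apply Finset.sum_le_card_nsmul
          intro P hP
          rw [Finite.mem_toFinset] at hP
          exact hfibBig P hP
        · apply Finset.sum_le_card_nsmul
          intro P hP
          rw [Finite.mem_toFinset] at hP
          exact hfibSmall P hP
    _ ≤ 40 := by
        rw [smul_eq_mul, smul_eq_mul, ← ncard_eq_toFinset_card _ hbigfin, ← ncard_eq_toFinset_card _ hsmallfin]
        omega

end Lines

end S1

end PercRepro
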